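import Summits.AtomisticToContinuum.BoseEinsteinCondensation.Theses.BECDyadicChaining
import Summits.AtomisticToContinuum.BoseEinsteinCondensation.Theorems.BECDyadicChainingDyadicCoherenceDefectReduction
import HarnessLib

/-!
# Crux `DyadicCoherenceDefect` (stmt-AtomisticToContinuum-13192): the limit-exchange split O ∧ U

Supports (does not close) stmt-AtomisticToContinuum-13192; filed by the crux-strategist r1 (second opinion,
STRATEGY-CENSUS v3 §Decomposition D7). The route `BECDyadicChaining` is CLOSED `exhausted` (2026-08-17) and the
crux is summit-strength (`Birth.boseEinsteinCondensation_of_dyadicCoherenceDefect`); this file records, as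
machine-checked bookkeeping, the ONE honest typed cut of the crux found by the census — along the ORDER OF
LIMITS — so that ladder / retarget seats can cite it:

* **O (fixed scales, thermodynamic limit first)** — hypothesis `hO` of
  `dyadicCoherenceDefect_of_scaleSplit`: the crux with the bracket quantifier `∀ j` moved IN FRONT of
  `∀ᶠ N` (the threshold in `N` may depend on the absolute scale `ℓ_d 2^j`), one summable budget `Σβ ≤ b_O`.
  Informally: ODLRO build-up of near-minimisers across FIXED absolute scales (condensate fraction of the
  `N → ∞` limit at scale `s`, then `s → ∞`) — the ODLRO form of BEC, itself open [LSSY2005, preface, Ch. 5].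
* **U (top scales, the exchange of limits)** — hypothesis `hU`: for every `ℓ_d > 0` and EVERY diverging cut
  `J : ℕ → ℕ`, the crux restricted to the brackets `j ≥ J N` (cube sides from `ℓ_d 2^{J N} → ∞` up to `L/2`),
  one summable budget `Σβ ≤ b_U`, `ρ₀` allowed to depend on `ℓ_d`.
* `dyadicCoherenceDefect_of_scaleSplit` — **O(b_O) → U(b_U) → DyadicCoherenceDefect** whenever
  `b_O + b_U ≤ 1/4` (kernel-checked glue: thresholds `N_j` from O give a diverging cut
  `J N := Nat.findGreatest (M · ≤ N) N`, `M j := max_{i ≤ j} N_i` — `diag_of_forall_eventually`; U is applied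
  to that `J`; `β := β_O + β_U`; the energy window is the minimum of U's window and O's windows for `j ≤ J N` —
  `exists_window_le`).
* `boseEinsteinCondensation_of_scaleSplit` — composed with `Birth.boseEinsteinCondensation_of_dyadicCoherenceDefect`:
  O ∧ U decide the conjunct.
* `fixedScale_of_dyadicCoherenceDefect` — O at budget `1/4` is a consequence of the crux (U at budget `1/2` is
  too, by re-indexing brackets; not needed here).

Status of the pieces (census v3): neither piece implies the conjunct or the crux by any tree theorem
(`#h21_crux_probe` CLEAN on both; `piece → S`, `S → piece`, `piece → crux` batteries fail), but O is the
ODLRO-in-the-thermodynamic-limit form of condensation (open, summit-class) and U — the exchange of `N → ∞`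
with the scale sum — has no engine (barrier `KineticGapLengthScales`: every landed scale-resolved bound stops at
the N-independent kinetic window). Hence no redirect was filed; the split is banked for the ladder seed
`g4t-AtomisticToContinuum-DyadicCoherenceDefect` (O = its natural rung axis).

No analysis lives here; the file is quantifier bookkeeping (a diagonal argument and a finite minimum).

References: [LSSY2005] preface ("a general proof of Bose–Einstein condensation for interacting gases still
eludes us"), Ch. 5; [PenroseOnsager1956] (ODLRO).
-/

noncomputable section

open Filter MeasureTheory
open scoped ENNReal NNReal BigOperators
open Literature.MathematicalPhysics.QuantumManyBody.BoseGas

namespace Summit.AtomisticToContinuum.BoseEinsteinCondensation.Cruxes.DyadicCoherenceDefect.LimitExchange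

/-- Diagonal lemma: per-index eventual statements give one diverging cut `J` below which all the
statements hold eventually (`J N := Nat.findGreatest (M · ≤ N) N`, `M j := max_{i ≤ j} N_i`). -/
theorem diag_of_forall_eventually {P : ℕ → ℕ → Prop}
    (h : ∀ j, ∀ᶠ N in Filter.atTop, P j N) :
    ∃ J : ℕ → ℕ, Tendsto J atTop atTop ∧ ∀ᶠ N in Filter.atTop, ∀ j, j ≤ J N → P j N := by
  classical
  choose Nj hNj using fun j => Filter.eventually_atTop.1 (h j)
  let M : ℕ → ℕ := fun j => (Finset.range (j + 1)).sup Nj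
  have hNM : ∀ i j, i ≤ j → Nj i ≤ M j := fun i j hij =>
    Finset.le_sup (f := Nj) (Finset.mem_range.2 (Nat.lt_succ_of_le hij))
  let J : ℕ → ℕ := fun N => Nat.findGreatest (fun j => M j ≤ N) N
  refine ⟨J, ?_, ?_⟩
  · rw [tendsto_atTop_atTop]
    intro j
    refine ⟨max (M j) j, fun N hN => ?_⟩
    exact Nat.le_findGreatest ((le_max_right _ _).trans hN) ((le_max_left _ _).trans hN)
  · rw [Filter.eventually_atTop]
    refine ⟨M 0, fun N hN j hj => ?_⟩
    have hspec : M (J N) ≤ N :=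
      Nat.findGreatest_spec (P := fun j => M j ≤ N) (Nat.zero_le N) hN
    exact hNj j N ((hNM j (J N) hj).trans hspec)

/-- Finite minimum of energy windows. -/
theorem exists_window_le {δf : ℕ → ℝ≥0∞} {k : ℕ} (hδ : ∀ j, j ≤ k → 0 < δf j) {δ' : ℝ≥0∞}
    (hδ' : 0 < δ') :
    ∃ δ : ℝ≥0∞, 0 < δ ∧ δ ≤ δ' ∧ ∀ j, j ≤ k → δ ≤ δf j := by
  refine ⟨min δ' ((Finset.range (k + 1)).inf' ⟨0, by simp⟩ δf), ?_, min_le_left _ _, ?_⟩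
  · refine lt_min hδ' ?_
    rw [Finset.lt_inf'_iff]
    intro j hj
    exact hδ j (Nat.lt_succ_iff.1 (Finset.mem_range.1 hj))
  · intro j hj
    exact (min_le_right _ _).trans
      (Finset.inf'_le _ (Finset.mem_range.2 (Nat.lt_succ_of_le hj)))

/-- Budgets add. -/
theorem tsum_budget {βO βU : ℕ → ℝ} (hO : Summable βO) (hU : Summable βU) {b c : ℝ}
    (hOb : ∑' j, βO j ≤ b) (hUc : ∑' j, βU j ≤ c) :
    ∑' j, (βO j + βU j) ≤ b + c := by
  rw [hO.tsum_add hU]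
  exact add_le_add hOb hUc

/-- Monotonicity of the defect bound in the budget. -/
theorem bound_mono {x y c : ℝ≥0∞} {b b' : ℝ} (hbb' : b ≤ b') (h : x ≤ y + ENNReal.ofReal b * c) :
    x ≤ y + ENNReal.ofReal b' * c := by
  have hle : ENNReal.ofReal b ≤ ENNReal.ofReal b' := ENNReal.ofReal_le_ofReal hbb'
  exact h.trans (by gcongr)

/-- **The limit-exchange split, kernel-checked: O(b_O) → U(b_U) → `DyadicCoherenceDefect`** for
`b_O + b_U ≤ 1/4`. `hO` = piece O (fixed absolute scales, `∀ j` before `∀ᶠ N`), `hU` = piece U (brackets above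
an arbitrary diverging cut, for every `ℓ_d`). -/
theorem dyadicCoherenceDefect_of_scaleSplit {bO bU : ℝ} (hb : bO + bU ≤ 1 / 4)
    (hO :
      ∀ v : ℝ → ℝ≥0∞, IsRepulsiveFiniteRange v → ∃ ℓd : ℝ, 0 < ℓd ∧ ∃ ρ₀ : ℝ, 0 < ρ₀ ∧
        ∀ ρ : ℝ, 0 < ρ → ρ < ρ₀ → ∃ β : ℕ → ℝ, (∀ j, 0 ≤ β j) ∧ Summable β ∧ ∑' j, β j ≤ bO ∧
        ∀ j : ℕ, ∀ᶠ N : ℕ in Filter.atTop,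
          let L : ℝ := sideLength ρ N
          let φ : (m : ℕ) → (Fin 3 → Fin (2 ^ m)) → EuclideanSpace ℝ (Fin 3) → ℂ := fun m i =>
            Set.indicator {x : EuclideanSpace ℝ (Fin 3) | ∀ k : Fin 3,
              x k ∈ Set.Ioo (((i k : ℕ) : ℝ) * (L / 2 ^ m)) ((((i k : ℕ) : ℝ) + 1) * (L / 2 ^ m))}
              (fun _ => ((Real.sqrt ((L / 2 ^ m) ^ 3))⁻¹ : ℂ))
          ∃ δ : ℝ≥0∞, 0 < δ ∧ ∀ Ψ : TrialState N L, energy v Ψ ≤ groundStateEnergy v N L + δ →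
            let A : ℕ → ℝ≥0∞ := fun m => (8 : ℝ≥0∞) ^ (-(m : ℝ) / 2) *
              ∑ i : Fin 3 → Fin (2 ^ m), (occupation N (φ m i) Ψ.ψ) ^ (1 / 2 : ℝ)
            ∀ m : ℕ, 1 ≤ m → ℓd * 2 ^ j ≤ L / 2 ^ m → L / 2 ^ m < ℓd * 2 ^ (j + 1) →
              A m ≤ A (m - 1) + ENNReal.ofReal (β j) * (N : ℝ≥0∞) ^ (1 / 2 : ℝ))
    (hU :
      ∀ v : ℝ → ℝ≥0∞, IsRepulsiveFiniteRange v → ∀ ℓd : ℝ, 0 < ℓd → ∃ ρ₀ : ℝ, 0 < ρ₀ ∧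
        ∀ ρ : ℝ, 0 < ρ → ρ < ρ₀ → ∀ J : ℕ → ℕ, Tendsto J atTop atTop →
        ∃ β : ℕ → ℝ, (∀ j, 0 ≤ β j) ∧ Summable β ∧ ∑' j, β j ≤ bU ∧
        ∀ᶠ N : ℕ in Filter.atTop,
          let L : ℝ := sideLength ρ N
          let φ : (m : ℕ) → (Fin 3 → Fin (2 ^ m)) → EuclideanSpace ℝ (Fin 3) → ℂ := fun m i =>
            Set.indicator {x : EuclideanSpace ℝ (Fin 3) | ∀ k : Fin 3,
              x k ∈ Set.Ioo (((i k : ℕ) : ℝ) * (L / 2 ^ m)) ((((i k : ℕ) : ℝ) + 1) * (L / 2 ^ m))}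
              (fun _ => ((Real.sqrt ((L / 2 ^ m) ^ 3))⁻¹ : ℂ))
          ∃ δ : ℝ≥0∞, 0 < δ ∧ ∀ Ψ : TrialState N L, energy v Ψ ≤ groundStateEnergy v N L + δ →
            let A : ℕ → ℝ≥0∞ := fun m => (8 : ℝ≥0∞) ^ (-(m : ℝ) / 2) *
              ∑ i : Fin 3 → Fin (2 ^ m), (occupation N (φ m i) Ψ.ψ) ^ (1 / 2 : ℝ)
            ∀ m j : ℕ, 1 ≤ m → J N ≤ j → ℓd * 2 ^ j ≤ L / 2 ^ m → L / 2 ^ m < ℓd * 2 ^ (j + 1) →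
              A m ≤ A (m - 1) + ENNReal.ofReal (β j) * (N : ℝ≥0∞) ^ (1 / 2 : ℝ)) :
    Theses.BECDyadicChaining.DyadicCoherenceDefect := by
  intro v hv
  obtain ⟨ℓd, hℓd, ρ₀O, hρ₀O, HO⟩ := hO v hv
  obtain ⟨ρ₀U, hρ₀U, HU⟩ := hU v hv ℓd hℓd
  refine ⟨ℓd, hℓd, min ρ₀O ρ₀U, lt_min hρ₀O hρ₀U, fun ρ hρ hρlt => ?_⟩
  obtain ⟨βO, hβO0, hβOs, hβOt, HO'⟩ := HO ρ hρ (hρlt.trans_le (min_le_left _ _))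
  obtain ⟨J, hJ, hdiag⟩ := diag_of_forall_eventually HO'
  obtain ⟨βU, hβU0, hβUs, hβUt, HU'⟩ := HU ρ hρ (hρlt.trans_le (min_le_right _ _)) J hJ
  refine ⟨fun j => βO j + βU j, fun j => add_nonneg (hβO0 j) (hβU0 j), hβOs.add hβUs, ?_, ?_⟩
  · exact (tsum_budget hβOs hβUs hβOt hβUt).trans hb
  · filter_upwards [hdiag, HU'] with N hON hUN
    dsimp only at hON hUN ⊢
    obtain ⟨δU, hδU, HUΨ⟩ := hUN
    choose! δf hδf using hON
    obtain ⟨δ, hδ, hδU', hδO'⟩ := exists_window_le (fun j hj => (hδf j hj).1) hδU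
    refine ⟨δ, hδ, fun Ψ hΨ => ?_⟩
    intro m j hm hb1 hb2
    by_cases hjJ : J N ≤ j
    · exact bound_mono (show βU j ≤ βO j + βU j by linarith [hβO0 j])
        (HUΨ Ψ (hΨ.trans (add_le_add le_rfl hδU')) m j hm hjJ hb1 hb2)
    · have hj' : j ≤ J N := (not_le.1 hjJ).le
      exact bound_mono (show βO j ≤ βO j + βU j by linarith [hβU0 j])
        ((hδf j hj').2 Ψ (hΨ.trans (add_le_add le_rfl (hδO' j hj'))) m hm hb1 hb2)

/-- O ∧ U decide the conjunct (composition with `Birth.boseEinsteinCondensation_of_dyadicCoherenceDefect`). -/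
theorem boseEinsteinCondensation_of_scaleSplit {bO bU : ℝ} (hb : bO + bU ≤ 1 / 4)
    (hO :
      ∀ v : ℝ → ℝ≥0∞, IsRepulsiveFiniteRange v → ∃ ℓd : ℝ, 0 < ℓd ∧ ∃ ρ₀ : ℝ, 0 < ρ₀ ∧
        ∀ ρ : ℝ, 0 < ρ → ρ < ρ₀ → ∃ β : ℕ → ℝ, (∀ j, 0 ≤ β j) ∧ Summable β ∧ ∑' j, β j ≤ bO ∧
        ∀ j : ℕ, ∀ᶠ N : ℕ in Filter.atTop,
          let L : ℝ := sideLength ρ N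
          let φ : (m : ℕ) → (Fin 3 → Fin (2 ^ m)) → EuclideanSpace ℝ (Fin 3) → ℂ := fun m i =>
            Set.indicator {x : EuclideanSpace ℝ (Fin 3) | ∀ k : Fin 3,
              x k ∈ Set.Ioo (((i k : ℕ) : ℝ) * (L / 2 ^ m)) ((((i k : ℕ) : ℝ) + 1) * (L / 2 ^ m))}
              (fun _ => ((Real.sqrt ((L / 2 ^ m) ^ 3))⁻¹ : ℂ))
          ∃ δ : ℝ≥0∞, 0 < δ ∧ ∀ Ψ : TrialState N L, energy v Ψ ≤ groundStateEnergy v N L + δ →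
            let A : ℕ → ℝ≥0∞ := fun m => (8 : ℝ≥0∞) ^ (-(m : ℝ) / 2) *
              ∑ i : Fin 3 → Fin (2 ^ m), (occupation N (φ m i) Ψ.ψ) ^ (1 / 2 : ℝ)
            ∀ m : ℕ, 1 ≤ m → ℓd * 2 ^ j ≤ L / 2 ^ m → L / 2 ^ m < ℓd * 2 ^ (j + 1) →
              A m ≤ A (m - 1) + ENNReal.ofReal (β j) * (N : ℝ≥0∞) ^ (1 / 2 : ℝ))
    (hU :
      ∀ v : ℝ → ℝ≥0∞, IsRepulsiveFiniteRange v → ∀ ℓd : ℝ, 0 < ℓd → ∃ ρ₀ : ℝ, 0 < ρ₀ ∧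
        ∀ ρ : ℝ, 0 < ρ → ρ < ρ₀ → ∀ J : ℕ → ℕ, Tendsto J atTop atTop →
        ∃ β : ℕ → ℝ, (∀ j, 0 ≤ β j) ∧ Summable β ∧ ∑' j, β j ≤ bU ∧
        ∀ᶠ N : ℕ in Filter.atTop,
          let L : ℝ := sideLength ρ N
          let φ : (m : ℕ) → (Fin 3 → Fin (2 ^ m)) → EuclideanSpace ℝ (Fin 3) → ℂ := fun m i =>
            Set.indicator {x : EuclideanSpace ℝ (Fin 3) | ∀ k : Fin 3,
              x k ∈ Set.Ioo (((i k : ℕ) : ℝ) * (L / 2 ^ m)) ((((i k : ℕ) : ℝ) + 1) * (L / 2 ^ m))}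
              (fun _ => ((Real.sqrt ((L / 2 ^ m) ^ 3))⁻¹ : ℂ))
          ∃ δ : ℝ≥0∞, 0 < δ ∧ ∀ Ψ : TrialState N L, energy v Ψ ≤ groundStateEnergy v N L + δ →
            let A : ℕ → ℝ≥0∞ := fun m => (8 : ℝ≥0∞) ^ (-(m : ℝ) / 2) *
              ∑ i : Fin 3 → Fin (2 ^ m), (occupation N (φ m i) Ψ.ψ) ^ (1 / 2 : ℝ)
            ∀ m j : ℕ, 1 ≤ m → J N ≤ j → ℓd * 2 ^ j ≤ L / 2 ^ m → L / 2 ^ m < ℓd * 2 ^ (j + 1) →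
              A m ≤ A (m - 1) + ENNReal.ofReal (β j) * (N : ℝ≥0∞) ^ (1 / 2 : ℝ)) :
    _root_.BoseEinsteinCondensation :=
  Birth.boseEinsteinCondensation_of_dyadicCoherenceDefect (dyadicCoherenceDefect_of_scaleSplit hb hO hU)

/-- Piece O at budget `1/4` is a consequence of the crux (specialise the bracket index). -/
theorem fixedScale_of_dyadicCoherenceDefect (hC : Theses.BECDyadicChaining.DyadicCoherenceDefect) :
    ∀ v : ℝ → ℝ≥0∞, IsRepulsiveFiniteRange v → ∃ ℓd : ℝ, 0 < ℓd ∧ ∃ ρ₀ : ℝ, 0 < ρ₀ ∧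
      ∀ ρ : ℝ, 0 < ρ → ρ < ρ₀ → ∃ β : ℕ → ℝ, (∀ j, 0 ≤ β j) ∧ Summable β ∧ ∑' j, β j ≤ 1 / 4 ∧
      ∀ j : ℕ, ∀ᶠ N : ℕ in Filter.atTop,
        let L : ℝ := sideLength ρ N
        let φ : (m : ℕ) → (Fin 3 → Fin (2 ^ m)) → EuclideanSpace ℝ (Fin 3) → ℂ := fun m i =>
          Set.indicator {x : EuclideanSpace ℝ (Fin 3) | ∀ k : Fin 3,
            x k ∈ Set.Ioo (((i k : ℕ) : ℝ) * (L / 2 ^ m)) ((((i k : ℕ) : ℝ) + 1) * (L / 2 ^ m))}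
            (fun _ => ((Real.sqrt ((L / 2 ^ m) ^ 3))⁻¹ : ℂ))
        ∃ δ : ℝ≥0∞, 0 < δ ∧ ∀ Ψ : TrialState N L, energy v Ψ ≤ groundStateEnergy v N L + δ →
          let A : ℕ → ℝ≥0∞ := fun m => (8 : ℝ≥0∞) ^ (-(m : ℝ) / 2) *
            ∑ i : Fin 3 → Fin (2 ^ m), (occupation N (φ m i) Ψ.ψ) ^ (1 / 2 : ℝ)
          ∀ m : ℕ, 1 ≤ m → ℓd * 2 ^ j ≤ L / 2 ^ m → L / 2 ^ m < ℓd * 2 ^ (j + 1) →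
            A m ≤ A (m - 1) + ENNReal.ofReal (β j) * (N : ℝ≥0∞) ^ (1 / 2 : ℝ) := by
  intro v hv
  obtain ⟨ℓd, hℓd, ρ₀, hρ₀, H⟩ := hC v hv
  refine ⟨ℓd, hℓd, ρ₀, hρ₀, fun ρ hρ hρlt => ?_⟩
  obtain ⟨β, hβ0, hβs, hβt, H'⟩ := H ρ hρ hρlt
  refine ⟨β, hβ0, hβs, hβt, fun j => ?_⟩
  filter_upwards [H'] with N hN
  dsimp only at hN ⊢
  obtain ⟨δ, hδ, HΨ⟩ := hN
  exact ⟨δ, hδ, fun Ψ hΨ m hm hb1 hb2 => HΨ Ψ hΨ m j hm hb1 hb2⟩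

end Summit.AtomisticToContinuum.BoseEinsteinCondensation.Cruxes.DyadicCoherenceDefect.LimitExchange

end
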